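import Literature.AlgebraicGeometry.Resolution.MonomializationAlongValuationHeights
import Literature.AlgebraicGeometry.Resolution.Prop81HeadOfGlue
import Literature.AlgebraicGeometry.Resolution.DenominatorsFromExceptionalLocus
import Literature.AlgebraicGeometry.Resolution.RegularLocalRingsUFD
import Literature.AlgebraicGeometry.Resolution.ExcellentClosedSubschemes
import HarnessLib

/-!
# [CoP1] Prop. 8.1 (1): monomialization of one element in a finer local uniformization, with denominator control

Topic: `Literature/AlgebraicGeometry/Resolution`. PROOF side of `CossartPiltant2019ReductionP`
(`ArithmeticalThreefoldsLocal.lean`), input (C4). The hypothesis `hMono` of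
`head_conclusion_of_monomialization` (`Prop81HeadOfGlue.lean`) and of the chain
`cossartPiltant2019ReductionP_of_cjs_of_stableInertia_of_monomialization` is the model form of
[CoP1] Prop. 4.1 / Prop. 8.1 (1) (V. Cossart, O. Piltant, HAL hal-00139124, p. 22: "there
exists a local uniformization `S₂` of `(K/k, v)` such that `S₁ < S₂`, `(S₁)_f = (S₂)_f` and
`f S₂` is monomial"): an element `G` of the local ring `R_t` of a model `S[t]` of `K′` becomes a
unit times a monomial in a regular system of parameters of the local ring `R_{t′}` of a finer
model `S[t′]`, `t ⊆ t′ ⊆ K′`, whose generators are quotients `b/a` of elements of `R_t` with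
`a ∣ G^N` in `R_{t′}`. This file PROVES it (`exists_monomialization_with_denominators`) from
the embedded-resolution hypothesis `hEmb` of the chain (Cossart–Jannsen–Saito, Cor. 1.5):
`exists_localRing_monomial_heights_of_embeddedResolution` applied to `R_t` (excellent,
regular of dimension three by the dimension formula) with `K := Frac(S[t]) ⊆ E`; the abstract
finer local ring is identified with `R_{t ∪ u}`; its primes not containing `G` contract with
equal height, so — both rings being factorial (Auslander–Buchsbaum) — prime divisors not
dividing `G` contract to principal primes (EXC), and
`exists_denominator_dvd_pow_of_comap_span_prime` gives the denominator clause.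

Everything is PROVED; no named facts, definitions, instances or notation are introduced
(`hEmb` is the hypothesis of the chain, passed through).

## Sources

* V. Cossart, O. Piltant, J. Algebra 320 (2008) 1051–1082: Prop. 4.1, Prop. 8.1 (1) and its
  proof (HAL hal-00139124, pp. 6–7, 22). [CossartPiltant2008]
* V. Cossart, U. Jannsen, S. Saito (2020): Cor. 1.5 (the hypothesis `hEmb`). [CossartJannsenSaito2020]
* H. Matsumura, *Commutative Ring Theory*, Thm. 20.3. [Matsumura1987]
-/

noncomputable section

open AlgebraicGeometry CategoryTheory

namespace Literature.AlgebraicGeometry.Resolution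

universe u

open IsLocalRing _root_.Polynomial Function

section Monomialization

variable {S : Type u} [CommRing S] [IsRegularLocalRing S] {E : Type u} [Field E] [Algebra S E]
  [Algebra.IsAlgebraic S E]

set_option maxHeartbeats 1600000 in
/-- **[CoP1] Prop. 8.1 (1), model form with denominator control** (the hypothesis `hMono` of
`head_conclusion_of_monomialization`, discharged from `hEmb`): in the frame of the chain, for a
model `S[t]` of `K′ ∋ S` (`t ⊆ K′`) with regular local ring `R_t` and `0 ≠ G ∈ R_t` with
`v(G) > 0`, there is a finer model `S[t′]`, `t ⊆ t′ ⊆ K′`, with regular local ring `R_{t′}`, a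
regular system of parameters `x` of `R_{t′}` and `u` with `v(u) = 0` such that
`G = u ∏ x_c^{α_c}`, and every `z ∈ t′` is `b/a` with `a, b ∈ R_t`, `a ≠ 0`, `a ∣ G^N` in
`R_{t′}` ("`S₁ < S₂`, `(S₁)_f = (S₂)_f` and `f S₂` is monomial").
[cite: CossartPiltant2008, Prop. 4.1 and Prop. 8.1 (1) (HAL pp. 6–7, 22)]
[cite: CossartJannsenSaito2020, Cor. 1.5] [cite: Matsumura1987, Thm. 20.3] -/
theorem exists_monomialization_with_denominators
    (hEmb : ∀ (Z : Scheme.{u}) [IsIntegral Z] [IsNoetherian Z], Scheme.IsRegular Z →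
      Scheme.IsExcellent Z → ∀ (X : Set Z), IsClosed X → X ≠ Set.univ → topologicalKrullDim X ≤ 2 →
        ∃ (Z' : Scheme.{u}) (π : Z' ⟶ Z), IsProper π ∧ Function.Surjective π.base ∧
          (∃ U : Z.Opens, (U : Set Z) = Xᶜ ∧ IsIso (π ∣_ U)) ∧
          IsStrictNormalCrossingsDivisor Z' (π.base ⁻¹' X))
    (hS : IsExcellentRing S) (hSdim : ringKrullDim S = 3)
    (hinj : Function.Injective (algebraMap S E))
    (OE : ValuationSubring E) (hSO : ∀ s : S, algebraMap S E s ∈ OE)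
    (hdom : ∀ s ∈ maximalIdeal S, OE.valuation (algebraMap S E s) < 1)
    (hres : ∀ y : OE, ∃ q : S[X], (∃ i, q.coeff i ∉ maximalIdeal S) ∧
      OE.valuation (q.eval₂ (algebraMap S E) y) < 1)
    (K' : Subfield E) (hSK' : ∀ s : S, algebraMap S E s ∈ K')
    (t : Finset E) (htK : (t : Set E) ⊆ K')
    (hTO : (Algebra.adjoin S (t : Set E)).toSubring ≤ OE.toSubring)
    (hreg : IsRegularLocalRing (locAtCentre (Algebra.adjoin S (t : Set E)).toSubring OE))
    (G : E) (hG : G ∈ locAtCentre (Algebra.adjoin S (t : Set E)).toSubring OE) (hG0 : G ≠ 0)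
    (hvG : OE.valuation G < 1) :
    ∃ t' : Finset E, t ⊆ t' ∧ (t' : Set E) ⊆ K' ∧
      ∃ hT'O : (Algebra.adjoin S (t' : Set E)).toSubring ≤ OE.toSubring,
      IsRegularLocalRing (locAtCentre (Algebra.adjoin S (t' : Set E)).toSubring OE) ∧
      ∃ (x : Fin 3 → locAtCentre (Algebra.adjoin S (t' : Set E)).toSubring OE) (u : E)
        (α : Fin 3 → ℕ),
        (haveI := isLocalRing_locAtCentre hT'O
         Ideal.span (Set.range x) = maximalIdeal _) ∧
        u ∈ locAtCentre (Algebra.adjoin S (t' : Set E)).toSubring OE ∧ OE.valuation u = 1 ∧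
        G = u * ∏ c, (x c : E) ^ α c ∧
        ∀ z ∈ (t' : Set E), ∃ a b : E,
          a ∈ locAtCentre (Algebra.adjoin S (t : Set E)).toSubring OE ∧
          b ∈ locAtCentre (Algebra.adjoin S (t : Set E)).toSubring OE ∧ a ≠ 0 ∧ z * a = b ∧
          ∃ (N : ℕ) (c : E), c ∈ locAtCentre (Algebra.adjoin S (t' : Set E)).toSubring OE ∧
            G ^ N = a * c := by
  classical
  haveI : IsDomain S := isDomain_of_isRegularLocalRing S
  have hSuc : IsUniversallyCatenaryRing S := hS.isUniversallyCatenaryRing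
  -- the model `S[t]`, its local ring `R_t`, and the field `K₀ = Frac(S[t])` inside `E`
  set T₀ : Subalgebra S E := Algebra.adjoin S (t : Set E) with hT₀def
  set Rt : Subring E := locAtCentre T₀.toSubring OE with hRtdef
  haveI hRtreg : IsRegularLocalRing Rt := hreg
  haveI : IsDomain Rt := isDomain_of_isRegularLocalRing Rt
  have hRtO : Rt ≤ OE.toSubring := locAtCentre_le hTO
  let K₀ : Subfield E := Subfield.closure (Set.range (algebraMap S E) ∪ (t : Set E))
  have hK₀K' : K₀ ≤ K' :=
    Subfield.closure_le.mpr (Set.union_subset (by rintro _ ⟨s, rfl⟩; exact hSK' s) htK)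
  have hT₀K₀ : T₀.toSubring ≤ K₀.toSubring := by
    rw [hT₀def, Algebra.adjoin_eq_ring_closure]
    exact Subring.closure_le.mpr Subfield.subset_closure
  have hRtK₀ : Rt ≤ K₀.toSubring := locAtCentre_le_subfield T₀.toSubring OE K₀ hT₀K₀
  letI : Algebra Rt K₀ := (Subring.inclusion hRtK₀).toAlgebra
  haveI : IsScalarTower Rt K₀ E := IsScalarTower.of_algebraMap_eq fun _ => rfl
  have hRK : Function.Injective (algebraMap Rt K₀) := fun a b hab =>
    Subtype.ext (congrArg Subtype.val hab :)
  -- `R_t` is excellent of dimension three, dominated by `O_E`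
  haveI : Algebra.FiniteType S T₀ :=
    (Subalgebra.fg_iff_finiteType _).mp (Subalgebra.fg_adjoin_finset _)
  have hexcRt : IsExcellentRing Rt := by
    let P₀ : Ideal T₀ := Ideal.comap (Subring.inclusion hTO) (maximalIdeal OE)
    haveI : P₀.IsPrime := Ideal.IsPrime.comap _
    have h := isExcellentRing_localization_atPrime hS P₀
    exact h.of_ringEquiv (locAtCentreEquiv hTO).toRingEquiv
  have hdimRt : ringKrullDim Rt = 3 := by
    rw [hRtdef, ringKrullDim_locAtCentre_eq_of_frame hSuc hinj OE hSO hdom hres T₀ hTO, hSdim]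
  have hRtm : ∀ r : Rt, r ∈ maximalIdeal Rt ↔ OE.valuation (algebraMap Rt E r) < 1 := fun r =>
    mem_maximalIdeal_locAtCentre_iff hTO r
  -- monomialize `G` in a finer regular local ring `R'` (embedded resolution), with heights
  obtain ⟨uu, huuK₀, huuO, R', _, _, _, hR'inj, hR'O, hR'm, hrange, hfrac, ⟨f, hfE, hEXC⟩, d, z,
      α, u, hu, hdimR', hz, hGmono⟩ :=
    exists_localRing_monomial_heights_of_embeddedResolution hEmb (R := Rt) (K := K₀) (E := E)
      hRK hexcRt hdimRt OE (fun r => hRtO r.2) hRtm ⟨G, hG⟩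
      (fun h => hG0 (congrArg Subtype.val h)) ((hRtm _).mpr hvG)
  haveI : IsDomain R' := isDomain_of_isRegularLocalRing R'
  -- the finer model `S[t ∪ uu]` and its local ring `R₁`, identified with `R'`
  set t' : Finset E := t ∪ uu with ht'def
  set T₁ : Subalgebra S E := Algebra.adjoin S (t' : Set E) with hT₁def
  set R₁ : Subring E := locAtCentre T₁.toSubring OE with hR₁def
  have hT₀T₁ : T₀.toSubring ≤ T₁.toSubring := fun y hy =>
    (Algebra.adjoin_mono (show (t : Set E) ⊆ (t' : Set E) from
      by rw [ht'def, Finset.coe_union]; exact Set.subset_union_left) : T₀ ≤ T₁) hy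
  have hRtR₁ : Rt ≤ R₁ := locAtCentre_mono OE hT₀T₁
  have hT₁adj : ∀ y ∈ T₁, y ∈ Algebra.adjoin Rt (uu : Set E) := by
    intro y hy
    refine Algebra.adjoin_induction (p := fun y _ => y ∈ Algebra.adjoin Rt (uu : Set E))
      ?_ ?_ (fun _ _ _ _ => add_mem) (fun _ _ _ _ => mul_mem) hy
    · intro w hw
      rcases Finset.mem_union.mp (Finset.mem_coe.mp hw) with hwt | hwu
      · have hwRt : w ∈ Rt := le_locAtCentre _ _ (Algebra.subset_adjoin (Finset.mem_coe.mpr hwt))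
        exact (Algebra.adjoin Rt (uu : Set E)).algebraMap_mem ⟨w, hwRt⟩
      · exact Algebra.subset_adjoin (Finset.mem_coe.mpr hwu)
    · intro s
      have hsRt : algebraMap S E s ∈ Rt := le_locAtCentre _ _ (T₀.algebraMap_mem s)
      exact (Algebra.adjoin Rt (uu : Set E)).algebraMap_mem ⟨_, hsRt⟩
  have hadjR₁ : ∀ y ∈ Algebra.adjoin Rt (uu : Set E), y ∈ R₁ := by
    intro y hy
    refine Algebra.adjoin_induction (p := fun y _ => y ∈ R₁) ?_ ?_ (fun _ _ _ _ => add_mem)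
      (fun _ _ _ _ => mul_mem) hy
    · intro w hw
      exact le_locAtCentre _ _ (Algebra.subset_adjoin
        (by rw [ht'def, Finset.coe_union]; exact Set.mem_union_right _ hw))
    · intro r
      exact hRtR₁ r.2
  have hT'O : T₁.toSubring ≤ OE.toSubring := fun y hy => huuO y (hT₁adj y hy)
  have hrangeR₁ : ∀ r : R', algebraMap R' E r ∈ R₁ := by
    intro r
    obtain ⟨τ, σ, hτ, hσ, hvσ, hr⟩ := hfrac r
    have hσ0 := ne_zero_of_valuation_eq_one hvσ
    have h1 : algebraMap R' E r = τ / σ := by rw [eq_div_iff hσ0, hr]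
    have h2 : τ / σ ∈ locAtCentre R₁ OE := ⟨τ, hadjR₁ τ hτ, σ, hadjR₁ σ hσ, hvσ, rfl⟩
    rw [hR₁def, locAtCentre_locAtCentre] at h2
    rw [h1, hR₁def]
    exact h2
  have hR₁range : ∀ y ∈ R₁, ∃ r : R', algebraMap R' E r = y := by
    rintro _ ⟨a, ha, b, hb, hvb, rfl⟩
    obtain ⟨a', ha'⟩ := hrange a (hT₁adj a ha)
    obtain ⟨b', hb'⟩ := hrange b (hT₁adj b hb)
    have hb'u : IsUnit b' := by
      by_contra hnu
      have h := (hR'm b').mp ((IsLocalRing.mem_maximalIdeal _).mpr hnu)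
      rw [hb', hvb] at h
      exact lt_irrefl _ h
    obtain ⟨bi, hbi⟩ := hb'u.exists_right_inv
    refine ⟨a' * bi, ?_⟩
    have hbiE : algebraMap R' E bi = b⁻¹ := by
      have h1 : algebraMap R' E b' * algebraMap R' E bi = 1 := by rw [← map_mul, hbi, map_one]
      rw [hb'] at h1
      exact eq_inv_of_mul_eq_one_right h1
    rw [map_mul, ha', hbiE, div_eq_mul_inv]
  let φ₀ : R' →+* R₁ := (algebraMap R' E).codRestrict R₁ hrangeR₁
  have hφ₀inj : Function.Injective φ₀ := fun a b h => hR'inj (congrArg Subtype.val h)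
  have hφ₀surj : Function.Surjective φ₀ := fun y => by
    obtain ⟨r, hr⟩ := hR₁range y y.2
    exact ⟨r, Subtype.ext hr⟩
  let φ : R' ≃+* R₁ := RingEquiv.ofBijective φ₀ ⟨hφ₀inj, hφ₀surj⟩
  have hφE : ∀ r : R', ((φ r : R₁) : E) = algebraMap R' E r := fun _ => rfl
  -- regularity and dimension of `R₁`; `d = 3`
  haveI hR₁reg : IsRegularLocalRing R₁ := IsRegularLocalRing.of_ringEquiv φ
  have hdimR₁ : ringKrullDim R₁ = 3 := by
    haveI : Algebra.FiniteType S T₁ :=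
      (Subalgebra.fg_iff_finiteType _).mp (Subalgebra.fg_adjoin_finset _)
    rw [hR₁def, ringKrullDim_locAtCentre_eq_of_frame hSuc hinj OE hSO hdom hres T₁ hT'O, hSdim]
  have hd3 : d = 3 := by
    have h : (d : WithBot ℕ∞) = 3 := by
      rw [← hdimR', ringKrullDim_eq_of_ringEquiv φ, hdimR₁]
    exact_mod_cast h
  subst hd3
  -- the regular system of parameters and the monomial form in `R₁`
  let x : Fin 3 → R₁ := fun i => φ (z i)
  have hxspan : Ideal.span (Set.range x) = maximalIdeal R₁ := by
    have hmap : (Ideal.span (Set.range z)).map φ.toRingHom = Ideal.span (Set.range x) := by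
      rw [Ideal.map_span, ← Set.range_comp]
      rfl
    rw [← hmap, hz]
    refine le_antisymm (fun y hy => ?_) (fun y hy => ?_)
    · obtain ⟨w, hw, rfl⟩ := (Ideal.mem_map_iff_of_surjective φ.toRingHom φ.surjective).mp hy
      rw [mem_maximalIdeal_locAtCentre_iff hT'O]
      exact (hR'm w).mp hw
    · have hvy : OE.valuation (y : E) < 1 := (mem_maximalIdeal_locAtCentre_iff hT'O y).mp hy
      have h1 : y = φ.toRingHom (φ.symm y) := (φ.apply_symm_apply y).symm
      rw [h1]
      refine Ideal.mem_map_of_mem _ ((hR'm _).mpr ?_)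
      rw [← hφE, φ.apply_symm_apply]
      exact hvy
  have hvu : OE.valuation (algebraMap R' E u) = 1 := by
    refine le_antisymm ((OE.valuation_le_one_iff _).mpr (hR'O u)) (not_lt.mp fun hlt => ?_)
    exact (IsLocalRing.mem_maximalIdeal _).mp ((hR'm u).mpr hlt) hu
  have hGeq : G = algebraMap R' E u * ∏ c, (x c : E) ^ α c := by
    have h := hGmono
    rw [map_mul, map_prod] at h
    simp only [map_pow] at h
    exact h
  -- both local rings are factorial; `φ ∘ f` is the inclusion `R_t ≤ R₁`
  have hufdRt : UniqueFactorizationMonoid Rt := uniqueFactorizationMonoid_of_isRegularLocalRing Rt hRtreg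
  have hufdR₁ : UniqueFactorizationMonoid R₁ := uniqueFactorizationMonoid_of_isRegularLocalRing R₁ hR₁reg
  have hφf : ∀ r : Rt, φ (f r) = Subring.inclusion hRtR₁ r := fun r =>
    Subtype.ext (by rw [hφE, hfE]; rfl)
  -- EXC: prime divisors of `R₁` not dividing `G` contract to principal primes of `R_t`
  have hEXC' : ∀ ϖ : R₁, Prime ϖ → ¬ ϖ ∣ ⟨G, hRtR₁ hG⟩ →
      ∃ π₀ : Rt, Prime π₀ ∧
        Ideal.comap (Subring.inclusion hRtR₁) (Ideal.span {ϖ}) = Ideal.span {π₀} := by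
    intro ϖ hϖ hndvd
    set Q : Ideal R₁ := Ideal.span {ϖ} with hQdef
    haveI hQp : Q.IsPrime := (Ideal.span_singleton_prime hϖ.ne_zero).mpr hϖ
    have hQht : Q.height = 1 :=
      Ideal.height_span_singleton_eq_one_of_mem_nonZeroDivisors
        (mem_nonZeroDivisors_of_ne_zero hϖ.ne_zero) hϖ.not_unit
    let Q' : Ideal R' := Q.comap φ
    haveI hQ'p : Q'.IsPrime := Ideal.IsPrime.comap _
    have hQ'ht : Q'.height = 1 := by rw [RingEquiv.height_comap φ Q, hQht]
    have hfG : f ⟨G, hG⟩ ∉ Q' := by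
      intro hmem
      apply hndvd
      have h1 : φ (f ⟨G, hG⟩) ∈ Q := hmem
      rw [hφf] at h1
      exact Ideal.mem_span_singleton.mp h1
    have hcomap : (Q'.comap f).height = Q'.height := hEXC Q' hQ'p hfG
    have hEq : Q'.comap f = Q.comap (Subring.inclusion hRtR₁) := by
      ext r
      simp only [Ideal.mem_comap]
      rw [← hφf]
      exact Iff.rfl
    haveI h𝔭p : (Q.comap (Subring.inclusion hRtR₁)).IsPrime := Ideal.IsPrime.comap _
    have h𝔭ht : (Q.comap (Subring.inclusion hRtR₁)).height = 1 := by rw [← hEq, hcomap, hQ'ht]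
    obtain ⟨π₀, hπ₀mem, hπ₀⟩ :=
      h𝔭p.exists_mem_prime_of_ne_bot (Ideal.ne_bot_of_height_eq_one h𝔭ht)
    exact ⟨π₀, hπ₀, Ideal.eq_span_singleton_of_height_eq_one h𝔭ht hπ₀mem hπ₀⟩
  -- assemble
  refine ⟨t', Finset.subset_union_left, ?_, hT'O, hR₁reg, x, algebraMap R' E u, α, hxspan,
    hrangeR₁ u, hvu, hGeq, ?_⟩
  · intro w hw
    rcases Finset.mem_union.mp (Finset.mem_coe.mp hw) with hwt | hwu
    · exact htK (Finset.mem_coe.mpr hwt)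
    · obtain ⟨w', hw'⟩ := huuK₀ (Finset.mem_coe.mpr hwu)
      rw [← hw']
      exact hK₀K' w'.2
  · intro w hw
    rcases Finset.mem_union.mp (Finset.mem_coe.mp hw) with hwt | hwu
    · exact ⟨1, w, one_mem _, le_locAtCentre _ _ (Algebra.subset_adjoin (Finset.mem_coe.mpr hwt)),
        one_ne_zero, mul_one w, 0, 1, one_mem _, by rw [pow_zero, one_mul]⟩
    · have hwK₀ : w ∈ K₀ := by
        obtain ⟨w', hw'⟩ := huuK₀ (Finset.mem_coe.mpr hwu)
        rw [← hw']
        exact w'.2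
      have hwR₁ : w ∈ R₁ := le_locAtCentre _ _ (Algebra.subset_adjoin
        (by rw [ht'def, Finset.coe_union]; exact Set.mem_union_right _ (Finset.mem_coe.mpr hwu)))
      have hzfrac : ∃ a b : E, a ∈ Rt ∧ b ∈ Rt ∧ b ≠ 0 ∧ w = a / b := by
        obtain ⟨y, hy, v, hv, hyv⟩ := Subfield.mem_closure_iff.mp hwK₀
        rw [← Algebra.adjoin_eq_ring_closure] at hy hv
        by_cases hv0 : v = 0
        · refine ⟨0, 1, zero_mem _, one_mem _, one_ne_zero, ?_⟩
          rw [← hyv, hv0, div_zero, zero_div]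
        · exact ⟨y, v, le_locAtCentre _ _ hy, le_locAtCentre _ _ hv, hv0, hyv.symm⟩
      obtain ⟨a, b, ha, hb, ha0, hwab, N, c, hc, hN⟩ :=
        exists_denominator_dvd_pow_of_comap_span_prime Rt R₁ hRtR₁ hufdRt hufdR₁ G hG hEXC' w hwR₁
          hzfrac
      exact ⟨a, b, ha, hb, ha0, hwab, N, c, hc, hN⟩

end Monomialization

end Literature.AlgebraicGeometry.Resolution

end
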